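import Mathlib
import Summits.Ventures.PercRepro2.Defs
import Summits.Ventures.PercRepro2.Graph
import Summits.Ventures.PercRepro2.OneColourSwitch
import Summits.Ventures.PercRepro2.RegionHubSign
import Summits.Ventures.PercRepro2.SideSwitch
import Summits.Ventures.PercRepro2.SideSwitchComps
import Summits.Ventures.PercRepro2.M9NoPocketDefs
import Summits.Ventures.PercRepro2.M9PocketRSEdgeTransfer
import Summits.Ventures.PercRepro2.M9PocketRootOnlyTransfer
import Summits.Ventures.PercRepro2.M9PocketRootOnlySum
import Summits.Ventures.PercRepro2.M9PocketRootOnlyD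

/-!
# The cut `{r, s}` and the `m9` sign sum (blind cell PercRepro2, p3 g41, 2026-08-29;
`proofs/P3-POCKETRK.md` §10⁵ (h))

Two general tools of the root-only calculus, for the full `m9` sign sum `Σ_{Sep} σ_pq σ_rs` as
well as for the single-`d` sum.  (1) A root-only cluster `L` (every edge at `L` ends in
`L ∪ {r, s}`; `p, q ∉ L`) factors out of the `m9` sign sum: `m9SignSum G = κ · m9SignSum (G − F)`
with `κ` = the number of colourings of the edges inside `L ∪ {r, s}` without an `r`–`s` link
(`m9SignSum_eq_mul_restrict_rootOnly`; the count lemma of `M9PocketRootOnlyD` with the trivial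
admissibility).  (2) When `{r, s}` SEPARATES `p` FROM `q` (a root-only cluster `L ∋ p` with
`q ∉ L`) every `Sep` colouring has `σ_pq = 0` — a path from `p` to `q` would leave `L` through
`r` or `s` (`sigma_pq_eq_zero_of_sep_of_mem`) — so the `m9` sign sum and every single-`d` sum
vanish (`m9SignSum_eq_zero_of_separated_pq`, `dSignSum_eq_zero_of_separated_pq`).  Together with
`dSignSum_nonpos_of_rootOnly_mem` this settles the single-`d` statement whenever the cut `{r, s}`
separates any two of `p`, `q`, `d`.  Own work; std axioms.
-/

namespace Summit.Ventures.PercRepro2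

namespace NoPocket

open Finset Classical OneColourSwitch SideSwitch

variable {V : Type*} {E : Type*} {ends : E → Sym2 V} {p q r s d : V} {L : Set V}

section M9

variable [Fintype E] [DecidableEq E]

/-- **A root-only cluster factors out of the `m9` sign sum**: `m9SignSum G = κ · m9SignSum (G − F)`
with `κ` = the number of colourings of the edges inside `L ∪ {r, s}` without an `r`–`s` link
through them. -/
theorem m9SignSum_eq_mul_restrict_rootOnly
    (hL : ∀ e x y, ends e = s(x, y) → x ∈ L → y ∈ L ∨ y = r ∨ y = s)
    (hp : p ∉ L) (hq : q ∉ L) (hr : r ∉ L) (hs : s ∉ L) :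
    m9SignSum ends p q r s =
    (∑ τ : ({e // ¬ (e ∉ within ends (L ∪ {r, s} : Set V))} → Bool),
      if ¬ Conn (fun e : {e // ¬ (e ∉ within ends (L ∪ {r, s} : Set V))} => ends e.1) τ r s then
        (1 : ℤ) else 0) *
    m9SignSum (fun e : {e // e ∉ within ends (L ∪ {r, s} : Set V)} => ends e.1) p q r s := by
  unfold m9SignSum
  rw [← (Equiv.piEquivPiSubtypeProd (fun e => e ∉ within ends (L ∪ {r, s} : Set V))
    (fun _ => Bool)).symm.sum_comp, Fintype.sum_prod_type, Finset.mul_sum]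
  refine Finset.sum_congr rfl fun ω' _ => ?_
  have hsep : ∀ τ : ({e // ¬ (e ∉ within ends (L ∪ {r, s} : Set V))} → Bool),
      sep2 ends p q r s ((Equiv.piEquivPiSubtypeProd
        (fun e => e ∉ within ends (L ∪ {r, s} : Set V)) (fun _ => Bool)).symm (ω', τ)) ↔
      sep2 (fun e : {e // e ∉ within ends (L ∪ {r, s} : Set V)} => ends e.1) p q r s ω' := by
    intro τ
    rw [sep2_restrict_iff_rootOnly hL hp hq, restrict_glue_rootOnly]
  by_cases h : sep2 (fun e : {e // e ∉ within ends (L ∪ {r, s} : Set V)} => ends e.1) p q r s ω'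
  · rw [if_pos h]
    have key := sum_sigma_rs_glue_of_compl_iff hL hr hs (fun _ => True) (fun _ => Iff.rfl) ω'
    simp only [if_true, true_and] at key
    calc ∑ τ : ({e // ¬ (e ∉ within ends (L ∪ {r, s} : Set V))} → Bool),
          (if sep2 ends p q r s ((Equiv.piEquivPiSubtypeProd
              (fun e => e ∉ within ends (L ∪ {r, s} : Set V)) (fun _ => Bool)).symm (ω', τ)) then
            sigma ends ((Equiv.piEquivPiSubtypeProd
              (fun e => e ∉ within ends (L ∪ {r, s} : Set V)) (fun _ => Bool)).symm (ω', τ)) p q *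
            sigma ends ((Equiv.piEquivPiSubtypeProd
              (fun e => e ∉ within ends (L ∪ {r, s} : Set V)) (fun _ => Bool)).symm (ω', τ)) r s
          else 0)
        = ∑ τ : ({e // ¬ (e ∉ within ends (L ∪ {r, s} : Set V))} → Bool),
          sigma (fun e : {e // e ∉ within ends (L ∪ {r, s} : Set V)} => ends e.1) ω' p q *
            sigma ends ((Equiv.piEquivPiSubtypeProd
              (fun e => e ∉ within ends (L ∪ {r, s} : Set V)) (fun _ => Bool)).symm (ω', τ)) r s := by
          refine Finset.sum_congr rfl fun τ _ => ?_
          rw [if_pos ((hsep τ).2 h), sigma_pq_glue_eq_rootOnly hL hp ω' τ ((hsep τ).2 h)]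
      _ = sigma (fun e : {e // e ∉ within ends (L ∪ {r, s} : Set V)} => ends e.1) ω' p q *
          ∑ τ : ({e // ¬ (e ∉ within ends (L ∪ {r, s} : Set V))} → Bool),
            sigma ends ((Equiv.piEquivPiSubtypeProd
              (fun e => e ∉ within ends (L ∪ {r, s} : Set V)) (fun _ => Bool)).symm (ω', τ)) r s := by
          rw [Finset.mul_sum]
      _ = _ := by rw [key]; ring
  · rw [if_neg h, mul_zero]
    refine Finset.sum_eq_zero fun τ _ => ?_
    rw [if_neg (fun h' => h ((hsep τ).1 h'))]

end M9

section SeparatedPQ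

/-- A `Y`-path from `p ∈ L` (a root-only cluster) to a vertex outside `L` leaves `L` through
`r` or `s`. -/
lemma conn_mark_of_conn_of_mem {ω : Config E}
    (hL : ∀ e x y, ends e = s(x, y) → x ∈ L → y ∈ L ∨ y = r ∨ y = s) (hp : p ∈ L) {z : V}
    (hz : z ∉ L) (h : Conn ends ω p z) : Conn ends ω p r ∨ Conn ends ω p s := by
  have key : z ∈ {y | (y ∈ L ∧ Conn ends ω p y) ∨ Conn ends ω p r ∨ Conn ends ω p s} := by
    refine mem_of_conn_of_closed ?_ (Or.inl ⟨hp, conn_refl _ _ _⟩) h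
    intro a ha b hab
    simp only [Set.mem_setOf_eq] at ha ⊢
    rcases ha with ⟨haL, hpa⟩ | ha
    · obtain ⟨_, e, he, hends⟩ := openGraph_adj.1 hab
      have hpb : Conn ends ω p b := conn_trans hpa (conn_of_openAdj ⟨e, he, hends⟩)
      rcases hL e a b hends haL with hbL | rfl | rfl
      · exact Or.inl ⟨hbL, hpb⟩
      · exact Or.inr (Or.inl hpb)
      · exact Or.inr (Or.inr hpb)
    · exact Or.inr ha
  simp only [Set.mem_setOf_eq] at key
  rcases key with ⟨hzL, _⟩ | h'
  · exact (hz hzL).elim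
  · exact h'

/-- **`{r, s}` separates `p` from `q` ⇒ `σ_pq = 0` on every `Sep` colouring.** -/
lemma sigma_pq_eq_zero_of_sep_of_mem {ω : Config E}
    (hL : ∀ e x y, ends e = s(x, y) → x ∈ L → y ∈ L ∨ y = r ∨ y = s) (hp : p ∈ L) (hq : q ∉ L)
    (hsep : sep2 ends p q r s ω) : sigma ends ω p q = 0 := by
  obtain ⟨⟨h1, h2, _, _⟩, ⟨h5, h6, _, _⟩⟩ := hsep
  have hY : ¬ Conn ends ω p q := fun h =>
    (conn_mark_of_conn_of_mem hL hp hq h).elim h1 h2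
  have hW : ¬ Conn ends (OneColourSwitch.compl ω) p q := fun h =>
    (conn_mark_of_conn_of_mem (ω := OneColourSwitch.compl ω) hL hp hq h).elim h5 h6
  unfold sigma
  rw [if_neg hY, if_neg hW]
  rfl

variable [Fintype E] [DecidableEq E]

/-- **The `m9` sign sum vanishes when `{r, s}` separates `p` from `q`.** -/
theorem m9SignSum_eq_zero_of_separated_pq
    (hL : ∀ e x y, ends e = s(x, y) → x ∈ L → y ∈ L ∨ y = r ∨ y = s) (hp : p ∈ L) (hq : q ∉ L) :
    m9SignSum ends p q r s = 0 := by
  unfold m9SignSum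
  refine Finset.sum_eq_zero fun ω _ => ?_
  by_cases h : sep2 ends p q r s ω
  · rw [if_pos h, sigma_pq_eq_zero_of_sep_of_mem hL hp hq h, zero_mul]
  · rw [if_neg h]

/-- **Every single-`d` sign sum vanishes when `{r, s}` separates `p` from `q`.** -/
theorem dSignSum_eq_zero_of_separated_pq
    (hL : ∀ e x y, ends e = s(x, y) → x ∈ L → y ∈ L ∨ y = r ∨ y = s) (hp : p ∈ L) (hq : q ∉ L) :
    dSignSum ends p q r s d = 0 := by
  unfold dSignSum
  refine Finset.sum_eq_zero fun ω _ => ?_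
  by_cases h : sep2 ends p q r s ω ∧ DOne ends r s d ω
  · rw [if_pos h, sigma_pq_eq_zero_of_sep_of_mem hL hp hq h.1, zero_mul]
  · rw [if_neg h]

end SeparatedPQ

end NoPocket

end Summit.Ventures.PercRepro2
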